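import Literature.NumberTheory.Automorphic.Liu2021.Thm418AsPrinted
import HarnessLib

/-!
# [Liu2021, Thm. 4.18] AS PRINTED is invariant under isomorphism of the TOWER-SIDE carriers `Ω(μ)`, `Hom_E(A_K, A_μ)_ℚ`

Structural lemma, companion of `Liu2021/Thm418Transport.lean` (which moves the GROUP `𝔾(𝔸_F^∞)` and the Weil-side carriers
`ε, χ, ω(μ, ε, χ)` but keeps `Ω(μ)`, `Hom_E(A_K, A_μ)_ℚ` and the canonical maps verbatim).  Here the complementary half: if
`D : Thm418Data F E` satisfies `Thm418AsPrinted D`, then so does the datum `D.replaceΩ Ω′ ρ′ HomK′ res′` obtained by replacing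
`Ω(μ)` by an `M_μ[𝔾(𝔸_F^∞)]`-module `Ω′` ISOMORPHIC to it (`θ : Ω′ ≃ₗ[M_μ] Ω(μ)` equivariant) and the groups `Hom_E(A_K, A_μ)_ℚ` by
groups `HomK′ K D_μ` isomorphic to them (`η_K : HomK′ K D_μ ≃+ Hom_E(A_K, A_μ)_ℚ`) compatibly with the canonical maps
(`θ ∘ res′_K = res_K ∘ η_K`) — the transport-of-structure step that reads the printed theorem for the Albanese tower of ONE model of
the Shimura variety from the printed theorem for an ISOMORPHIC tower (e.g. two choices of canonical models, or the towers at complex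
conjugate embeddings; cell `hodgecm-mathlib`, hLiu418 off-place item (4)).  One `def` (the transported datum, by explicit formula) and
theorems; no named fact, no `sorry`; no mathematics of [Liu2021] is asserted; HC_CM is NOT proved.

References: [Liu2021] Y. Liu, *Fourier–Jacobi cycles and arithmetic relative trace formula*, Camb. J. Math. 9 (2021), Thm. 4.18
(FJcycle.tex l. 2232–2245), Def. 4.16, Rem. 4.17, §4.2 l. 2070–2074.
-/

set_option autoImplicit false

noncomputable section

open NumberField TensorProduct DirectSum

namespace Literature.NumberTheory.Automorphic.Liu2021

namespace Thm418Data

variable {F E : Type} [Field F] [NumberField F] [IsTotallyReal F] [Field E] [NumberField E] [Algebra F E]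
  [IsTotallyComplex E] [Algebra.IsQuadraticExtension F E]

/-- **The datum with the tower-side carriers replaced**: same `n, 𝕍, G, ε, χ, μ, 𝒜(μ), ω`; new `Ω(μ)′` with its `M_μ[𝔾(𝔸_F^∞)]`-structure,
new groups `Hom′_K` and new canonical maps `res′_K : Hom′_K → Ω(μ)′`. [cite: Liu2021, Thm. 4.18 (l. 2232–2245), Def. 4.16, Rem. 4.17] -/
def replaceΩ (D : Thm418Data F E) (Ω' : Type) [AddCommGroup Ω'] [Module (fieldOfValues E D.μ) Ω']
    (rhoΩ' : Representation (fieldOfValues E D.μ) D.G Ω') (HomK' : Subgroup D.G → D.Obj → Type)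
    [∀ K Dμ, AddCommGroup (HomK' K Dμ)] (res' : ∀ K Dμ, HomK' K Dμ →+ Ω') : Thm418Data F E where
  n := D.n
  two_le_n := D.two_le_n
  𝕍 := D.𝕍
  G := D.G
  Eps := D.Eps
  epsOf := D.epsOf
  Chi := D.Chi
  μ := D.μ
  isConjugateSymplectic := D.isConjugateSymplectic
  hasWeight_one := D.hasWeight_one
  Obj := D.Obj
  omega := D.omega
  rho := D.rho
  Ω := Ω'
  rhoΩ := rhoΩ'
  HomK := HomK'
  res := res'

section Replace

variable (D : Thm418Data F E) (Ω' : Type) [AddCommGroup Ω'] [Module (fieldOfValues E D.μ) Ω']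
  (rhoΩ' : Representation (fieldOfValues E D.μ) D.G Ω') (HomK' : Subgroup D.G → D.Obj → Type)
  [∀ K Dμ, AddCommGroup (HomK' K Dμ)] (res' : ∀ K Dμ, HomK' K Dμ →+ Ω')

/-- The invariants of `K` in `Ω(μ)′` are carried by `θ` onto the invariants of `K` in `Ω(μ)`. [cite: Liu2021, Thm. 4.18 (1)] -/
theorem mem_invariants_replaceΩ_iff (θ : Ω' ≃ₗ[fieldOfValues E D.μ] D.Ω)
    (hθ : ∀ (g : D.G) (x : Ω'), θ (rhoΩ' g x) = D.rhoΩ g (θ x)) (K : Subgroup D.G) (x : Ω') :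
    x ∈ (D.replaceΩ Ω' rhoΩ' HomK' res').invariants K ↔ θ x ∈ D.invariants K := by
  change (∀ k ∈ K, rhoΩ' k x = x) ↔ (∀ k ∈ K, D.rhoΩ k (θ x) = θ x)
  refine forall₂_congr fun k _ ↦ ?_
  rw [← hθ, θ.injective.eq_iff]

/-- `θ ⊗ ℂ` intertwines the base changes of `ρ′(g)` and `ρ(g)`. [cite: Liu2021, Thm. 4.18 (main statement)] -/
theorem baseChange_rhoΩ_replaceΩ (θ : Ω' ≃ₗ[fieldOfValues E D.μ] D.Ω)
    (hθ : ∀ (g : D.G) (x : Ω'), θ (rhoΩ' g x) = D.rhoΩ g (θ x)) (g : D.G) (x : ℂ ⊗[fieldOfValues E D.μ] Ω') :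
    (θ.baseChange (fieldOfValues E D.μ) ℂ Ω' D.Ω) ((rhoΩ' g).baseChange ℂ x) =
      (D.rhoΩ g).baseChange ℂ ((θ.baseChange (fieldOfValues E D.μ) ℂ Ω' D.Ω) x) := by
  change (θ : Ω' →ₗ[fieldOfValues E D.μ] D.Ω).baseChange ℂ ((rhoΩ' g).baseChange ℂ x) =
    (D.rhoΩ g).baseChange ℂ ((θ : Ω' →ₗ[fieldOfValues E D.μ] D.Ω).baseChange ℂ x)
  induction x using TensorProduct.induction_on with
  | zero => simp only [map_zero]
  | tmul c y =>
    rw [LinearMap.baseChange_tmul, LinearMap.baseChange_tmul, LinearMap.baseChange_tmul, LinearMap.baseChange_tmul,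
      LinearEquiv.coe_coe, hθ]
  | add x y hx hy => rw [map_add, map_add, hx, hy, map_add, map_add]

/-- `θ ⊗ ℂ` commutes with the Galois actions `σ ⊗ 1`. [cite: Liu2021, Thm. 4.18 (3)] -/
theorem baseChange_galoisAct_replaceΩ (θ : Ω' ≃ₗ[fieldOfValues E D.μ] D.Ω) (σ : ℂ ≃ₐ[fieldOfValues E D.μ] ℂ)
    (x : ℂ ⊗[fieldOfValues E D.μ] Ω') :
    (θ.baseChange (fieldOfValues E D.μ) ℂ Ω' D.Ω) ((D.replaceΩ Ω' rhoΩ' HomK' res').galoisAct σ x) =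
      D.galoisAct σ ((θ.baseChange (fieldOfValues E D.μ) ℂ Ω' D.Ω) x) := by
  change (θ : Ω' →ₗ[fieldOfValues E D.μ] D.Ω).baseChange ℂ ((σ.toLinearMap.rTensor Ω') x) =
    (σ.toLinearMap.rTensor D.Ω) ((θ : Ω' →ₗ[fieldOfValues E D.μ] D.Ω).baseChange ℂ x)
  induction x using TensorProduct.induction_on with
  | zero => simp only [map_zero]
  | tmul c y =>
    rw [LinearMap.rTensor_tmul, LinearMap.baseChange_tmul, LinearMap.baseChange_tmul, LinearMap.rTensor_tmul]
  | add x y hx hy => rw [map_add, map_add, hx, hy, map_add, map_add]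

/-- **TRANSPORT OF [Liu2021, Thm. 4.18] AS PRINTED along an isomorphism of the tower-side carriers**: from `Thm418AsPrinted D`, an
equivariant `θ : Ω′ ≃ Ω(μ)` and isomorphisms `η_K : Hom′_K ≃ Hom_E(A_K, A_μ)_ℚ` with `θ ∘ res′_K = res_K ∘ η_K`, the printed statement
holds for `D.replaceΩ Ω′ ρ′ Hom′ res′` (with `Φ′ := Φ ∘ (θ ⊗ ℂ)`; item (1) through `η`, `θ`; items (2), (3) unchanged).
[cite: Liu2021, Thm. 4.18 (l. 2232–2245)] -/
theorem thm418AsPrinted_replaceΩ (θ : Ω' ≃ₗ[fieldOfValues E D.μ] D.Ω)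
    (hθ : ∀ (g : D.G) (x : Ω'), θ (rhoΩ' g x) = D.rhoΩ g (θ x)) (η : ∀ K Dμ, HomK' K Dμ ≃+ D.HomK K Dμ)
    (hη : ∀ (K : Subgroup D.G) (Dμ : D.Obj) (x : HomK' K Dμ), θ (res' K Dμ x) = D.res K Dμ (η K Dμ x))
    (h : Liu2021.Thm418AsPrinted D) : Liu2021.Thm418AsPrinted (D.replaceΩ Ω' rhoΩ' HomK' res') := by
  obtain ⟨Φ, hmain, h1, h2, h3⟩ := h
  let T : (ℂ ⊗[fieldOfValues E D.μ] Ω') ≃ₗ[ℂ] ℂ ⊗[fieldOfValues E D.μ] D.Ω := θ.baseChange (fieldOfValues E D.μ) ℂ Ω' D.Ω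
  refine ⟨T.trans Φ, ?_, ?_, h2, ?_⟩
  · -- (main)
    intro g x i
    change Φ (T ((rhoΩ' g).baseChange ℂ x)) i = D.rhoAt i g (Φ (T x) i)
    rw [show T ((rhoΩ' g).baseChange ℂ x) = (D.rhoΩ g).baseChange ℂ (T x) from
      D.baseChange_rhoΩ_replaceΩ Ω' rhoΩ' θ hθ g x, hmain]
  · -- (1)
    intro Dμ
    obtain ⟨K₀, hK₀, hK⟩ := h1 Dμ
    refine ⟨K₀, hK₀, fun K hKo hle => ?_⟩
    obtain ⟨hinj, hrange⟩ := hK K hKo hle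
    have hres : ∀ x : HomK' K Dμ, res' K Dμ x = θ.symm (D.res K Dμ (η K Dμ x)) := fun x ↦ by
      rw [LinearEquiv.eq_symm_apply, hη]
    refine ⟨fun x y hxy => ?_, Set.ext fun z => ⟨?_, fun hz => ?_⟩⟩
    · have hxy' : D.res K Dμ (η K Dμ x) = D.res K Dμ (η K Dμ y) := by rw [← hη, ← hη]; exact congrArg θ hxy
      exact (η K Dμ).injective (hinj hxy')
    · rintro ⟨x, rfl⟩
      refine (D.mem_invariants_replaceΩ_iff Ω' rhoΩ' HomK' res' θ hθ K (res' K Dμ x)).2 ?_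
      rw [hη, ← hrange]
      exact ⟨_, rfl⟩
    · have hz' := (D.mem_invariants_replaceΩ_iff Ω' rhoΩ' HomK' res' θ hθ K z).1 hz
      rw [← hrange] at hz'
      obtain ⟨y, hy⟩ := hz'
      refine ⟨(η K Dμ).symm y, ?_⟩
      change res' K Dμ ((η K Dμ).symm y) = z
      rw [hres, AddEquiv.apply_symm_apply, hy, LinearEquiv.symm_apply_apply]
  · -- (3)
    intro ε hε σ x hx i hi
    change Φ (T ((D.replaceΩ Ω' rhoΩ' HomK' res').galoisAct σ x)) i = 0
    rw [show T ((D.replaceΩ Ω' rhoΩ' HomK' res').galoisAct σ x) = D.galoisAct σ (T x) from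
      D.baseChange_galoisAct_replaceΩ Ω' rhoΩ' HomK' res' θ σ x]
    exact h3 ε hε σ (T x) (fun j hj => hx j hj) i hi

end Replace

end Thm418Data

end Literature.NumberTheory.Automorphic.Liu2021

end
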